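import Summits.HubbardSuperconductivity.HubbardSuperconductivity.Theorems.AposterioriCapRgSsbToEvenTorusLroSourcedGroundVector
import Literature.MathematicalPhysics.QuantumLattice.HubbardLiebConfig
import Literature.MathematicalPhysics.QuantumLattice.HubbardSzSectorLadder
import Literature.MathematicalPhysics.QuantumLattice.HubbardModelParticleHoleProofs
import Literature.MathematicalPhysics.QuantumLattice.PairChirality
import HarnessLib

/-!
# Route `AposterioriCapRg` — crux `SsbToEvenTorusLro` (stmt-HubbardSuperconductivity-1315),
# line `number-projected-canonical-slope`, stub `stub_projectedChord` — helper file 2/3: sector bookkeeping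

Bookkeeping for the number-projected chord (file 3/3, `…ProjectedChord.lean`), all on the Hubbard torus `(ℤ/Lℤ)²`:

* `pc_sum_sectorProj_of_spinZ` — a vector with `S^z φ = (e/2)φ` is the sum of its `(N↑, N↓) = (b+e, b)` components
  `sectorProj (b+e) b φ`, `b ≤ L²`;
* `pc_quadratic_split` / `pc_norm_split` — quadratic forms of `(N↑, N↓)`-conserving matrices (and norms) split over
  the components (distinct sectors are orthogonal, `dotProduct_eq_zero_of_isInSector`); registered helper stub
  `stub_sectorQuadraticSplit` (the `∀`-closed form of `pc_quadratic_split`);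
* `pc_preservesSectors_blockOp`, `pc_preservesSectors_hubbard_add` — `W_R` and `H + κW_R` conserve `(N↑, N↓)`
  (`PairChirality.Shifts` grading of the local singlet pairs);
* `pc_numDev_eq_sum`, `pc_numDev_norm` — `N̂φ − Nφ = Σ_b (N_b − N)φ_b` and `‖N̂φ − Nφ‖² = Σ_b (N_b − N)²‖φ_b‖²`;
* `pc_abs_path_le`, `pc_weighted_cs`, `pc_re_norm_nonneg`, `pc_norm_toLp_eq_sqrt` — elementary real facts;
* `pc_gcFloor` — the grand-canonical floor `E₀(K_μ) ≤ minEnergyOn H (szSector N 0) − μN` under a nonzero sector.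

Folklore (Lieb, PRL 62 (1989) 1201, "work in a sector"; Tasaki 2020 §2.1–2.2, §9.3); no definition is introduced.
-/

noncomputable section

namespace Summit.HubbardSuperconductivity.HubbardSuperconductivity.Theorems

set_option linter.dupNamespace false

open Literature.MathematicalPhysics.QuantumLattice Literature.Probability.LatticeModels Matrix
open Literature.MathematicalPhysics.QuantumLattice.ThermodynamicLimit
open scoped Matrix ComplexOrder ComplexConjugate Matrix.Norms.L2Operator InnerProductSpace

section Chord

variable {L : ℕ} [NeZero L]

/-! ### Sector bookkeeping of a spin-balanced vector -/

omit [NeZero L] in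
/-- `|Λ_L| = L²` for the fermionic torus. [folklore] -/
theorem pc_card_fermionTorus : Fintype.card (FermionTorus 2 L) = L ^ 2 := by
  simp [FermionTorus, Fintype.card_fin]

omit [NeZero L] in
/-- **Sector decomposition of a weight-`e/2` vector**: if `S^z φ = (e/2) φ` then
`φ = Σ_{b ≤ L²} sectorProj (b+e) b φ`. [folklore] -/
theorem pc_sum_sectorProj_of_spinZ {e : ℕ} {φ : Fock (Orb (FermionTorus 2 L))}
    (hZ : HubbardWave0.spinZ *ᵥ φ = (((e : ℝ) / 2 : ℝ) : ℂ) • φ) :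
    ∑ b ∈ Finset.range (L ^ 2 + 1), sectorProj (b + e) b φ = φ := by
  funext s
  rw [Finset.sum_apply]
  simp only [sectorProj_apply]
  by_cases hs : φ s = 0
  · rw [hs]
    exact Finset.sum_eq_zero fun b _ => by split_ifs <;> rfl
  · have hco := congrFun hZ s
    rw [LiebThm1.spinZ_mulVec_apply, Pi.smul_apply, smul_eq_mul] at hco
    have h1 : (1 / 2 : ℂ) * (((upPart s).card : ℂ) - ((downPart s).card : ℂ)) = (((e : ℝ) / 2 : ℝ) : ℂ) :=
      mul_right_cancel₀ hs hco
    have h2 : ((upPart s).card : ℂ) = ((downPart s).card : ℂ) + (e : ℂ) := by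
      have h3 : ((upPart s).card : ℂ) - ((downPart s).card : ℂ) = 2 * (((e : ℝ) / 2 : ℝ) : ℂ) := by
        linear_combination 2 * h1
      have h4 : (2 : ℂ) * (((e : ℝ) / 2 : ℝ) : ℂ) = (e : ℂ) := by push_cast; ring
      linear_combination h3 + h4
    have hud : (upPart s).card = (downPart s).card + e := by exact_mod_cast h2
    have hb : (downPart s).card < L ^ 2 + 1 := by
      have := Finset.card_le_univ (downPart s)
      rw [pc_card_fermionTorus] at this
      omega
    rw [Finset.sum_eq_single (downPart s).card]
    · rw [if_pos ⟨hud, rfl⟩]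
    · intro b _ hb'
      rw [if_neg]
      rintro ⟨-, h⟩
      exact hb' h.symm
    · intro hmem
      exact absurd (Finset.mem_range.2 hb) hmem

omit [NeZero L] in
/-- **Splitting of quadratic forms over the `(b+e, b)` sectors** for a `(N↑, N↓)`-conserving matrix `M`:
`⟨Σ_b v_b, M Σ_b v_b⟩ = Σ_b ⟨v_b, M v_b⟩` when `v_b` lies in the sector `(b+e, b)`. [folklore] -/
theorem pc_quadratic_split {M : Matrix (Finset (Orb (FermionTorus 2 L))) (Finset (Orb (FermionTorus 2 L))) ℂ}
    (hM : PreservesSectors M) {e : ℕ} {v : ℕ → Fock (Orb (FermionTorus 2 L))}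
    (hv : ∀ b, IsInSector (b + e) b (v b)) (S : Finset ℕ) :
    star (∑ b ∈ S, v b) ⬝ᵥ (M *ᵥ ∑ b ∈ S, v b) = ∑ b ∈ S, star (v b) ⬝ᵥ (M *ᵥ v b) := by
  rw [mulVec_sum, star_sum, sum_dotProduct]
  refine Finset.sum_congr rfl fun b hb => ?_
  rw [dotProduct_sum]
  refine Finset.sum_eq_single_of_mem b hb fun b' _ hb' => ?_
  exact dotProduct_eq_zero_of_isInSector (fun h => hb' (by omega)) (hv b) (hM.isInSector_mulVec (hv b'))

omit [NeZero L] in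
/-- Splitting of the norm: `‖Σ_b v_b‖² = Σ_b ‖v_b‖²`. [folklore] -/
theorem pc_norm_split {e : ℕ} {v : ℕ → Fock (Orb (FermionTorus 2 L))}
    (hv : ∀ b, IsInSector (b + e) b (v b)) (S : Finset ℕ) :
    star (∑ b ∈ S, v b) ⬝ᵥ (∑ b ∈ S, v b) = ∑ b ∈ S, star (v b) ⬝ᵥ v b := by
  have h := pc_quadratic_split (PreservesSectors.diagonal fun _ => (1 : ℂ)) hv S
  simpa only [diagonal_one, one_mulVec] using h

/-- The Kac block operator `W_R` conserves `(N↑, N↓)` (each `B_aᴴ B_a` has grade `0`). [folklore] -/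
theorem pc_preservesSectors_blockOp (R : ℕ) :
    PreservesSectors ((((((R : ℝ) ^ 4)⁻¹ : ℝ) : ℂ) • ∑ a : TorusSite 2 L, (∑ u : Fin 2 → Fin R, localPair dWaveFormFactor L (a + fun i => ((u i : ℕ) : ZMod L)))ᴴ * (∑ u : Fin 2 → Fin R, localPair dWaveFormFactor L (a + fun i => ((u i : ℕ) : ZMod L))))) := by
  refine PreservesSectors.smul (PreservesSectors.sum fun a _ => ?_) _
  have hB : PairChirality.Shifts (-1) (-1)
      (∑ u : Fin 2 → Fin R, localPair dWaveFormFactor L (a + fun i => ((u i : ℕ) : ZMod L))) :=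
    PairChirality.Shifts.sum fun u _ => PairChirality.shifts_localPair L dWaveFormFactor _
  have h := hB.conjTranspose.mul hB
  simp only [Int.reduceNeg, neg_neg, add_neg_cancel] at h
  exact h.preservesSectors

/-- `H + κ W_R` conserves `(N↑, N↓)`. [folklore] -/
theorem pc_preservesSectors_hubbard_add (U κ : ℝ) (R : ℕ) :
    PreservesSectors (hubbardTorus 2 L 1 U + (κ : ℂ) • (((((R : ℝ) ^ 4)⁻¹ : ℝ) : ℂ) • ∑ a : TorusSite 2 L, (∑ u : Fin 2 → Fin R, localPair dWaveFormFactor L (a + fun i => ((u i : ℕ) : ZMod L)))ᴴ * (∑ u : Fin 2 → Fin R, localPair dWaveFormFactor L (a + fun i => ((u i : ℕ) : ZMod L))))) :=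
  (LiebThm1.preservesSectors_hamiltonian (fermionTorusGraph 2 L) 1 U).add
    ((pc_preservesSectors_blockOp R).smul _)

/-! ### Elementary real bookkeeping -/

/-- `|b + e − n| + |b − n| ≤ |2b + e − 2n| + 1` for `e ≤ 1`. [folklore] -/
theorem pc_abs_path_le {e : ℕ} (he : e ≤ 1) (b n : ℕ) :
    |((b + e : ℕ) : ℝ) - n| + |(b : ℝ) - n| ≤ |((2 * b + e : ℕ) : ℝ) - 2 * n| + 1 := by
  have he' : (e : ℝ) ≤ 1 := by exact_mod_cast he
  have he0 : (0 : ℝ) ≤ e := by positivity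
  push_cast
  set x : ℝ := (b : ℝ) - n with hx
  have e1 : (b : ℝ) + e - n = x + e := by rw [hx]; ring
  have e2 : 2 * (b : ℝ) + e - 2 * n = 2 * x + e := by rw [hx]; ring
  rw [e1, e2]
  rcases le_or_gt 0 x with h0 | h0
  · rw [abs_of_nonneg (by linarith), abs_of_nonneg h0, abs_of_nonneg (by linarith)]
    linarith
  · rcases le_or_gt 0 (x + e) with h1 | h1
    · rw [abs_of_nonneg h1, abs_of_neg h0]
      have : 0 ≤ |2 * x + e| := abs_nonneg _
      linarith
    · rw [abs_of_neg h1, abs_of_neg h0, abs_of_nonpos (by linarith)]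
      linarith

/-- Weighted Cauchy–Schwarz with unit total weight: `Σ p_b |y_b| ≤ (Σ p_b y_b²)^{1/2}`. [folklore] -/
theorem pc_weighted_cs (S : Finset ℕ) {p y : ℕ → ℝ} (hp : ∀ b ∈ S, 0 ≤ p b) (h1 : ∑ b ∈ S, p b = 1) :
    ∑ b ∈ S, p b * |y b| ≤ Real.sqrt (∑ b ∈ S, p b * y b ^ 2) := by
  have hcs := Finset.sum_mul_sq_le_sq_mul_sq S (fun b => Real.sqrt (p b)) (fun b => Real.sqrt (p b) * |y b|)
  have e1 : ∀ b ∈ S, Real.sqrt (p b) * (Real.sqrt (p b) * |y b|) = p b * |y b| := fun b hb => by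
    rw [← mul_assoc, Real.mul_self_sqrt (hp b hb)]
  have e2 : ∀ b ∈ S, Real.sqrt (p b) ^ 2 = p b := fun b hb => Real.sq_sqrt (hp b hb)
  have e3 : ∀ b ∈ S, (Real.sqrt (p b) * |y b|) ^ 2 = p b * y b ^ 2 := fun b hb => by
    rw [mul_pow, Real.sq_sqrt (hp b hb), sq_abs]
  rw [Finset.sum_congr rfl e1, Finset.sum_congr rfl e2, Finset.sum_congr rfl e3, h1, one_mul] at hcs
  refine Real.le_sqrt_of_sq_le hcs

/-! ### The number deviation of a spin-balanced vector -/

omit [NeZero L] in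
/-- `N̂ φ − N·φ = Σ_b (N_b − N) φ_b` over the `(b+e, b)` components, `N_b = (b+e)+b`. [folklore] -/
theorem pc_numDev_eq_sum {e : ℕ} {v : ℕ → Fock (Orb (FermionTorus 2 L))}
    (hv : ∀ b, IsInSector (b + e) b (v b)) (S : Finset ℕ) (N : ℕ) :
    totalNumber *ᵥ (∑ b ∈ S, v b) - (N : ℂ) • (∑ b ∈ S, v b) =
      ∑ b ∈ S, (((b + e + b : ℕ) : ℂ) - (N : ℂ)) • v b := by
  rw [mulVec_sum, Finset.smul_sum, ← Finset.sum_sub_distrib]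
  refine Finset.sum_congr rfl fun b _ => ?_
  rw [totalNumber_mulVec_of_isNParticle (hv b).isNParticle, sub_smul]

omit [NeZero L] in
/-- `‖N̂ φ − N·φ‖² = Σ_b (N_b − N)² ‖φ_b‖²`. [folklore] -/
theorem pc_numDev_norm {e : ℕ} {v : ℕ → Fock (Orb (FermionTorus 2 L))}
    (hv : ∀ b, IsInSector (b + e) b (v b)) (S : Finset ℕ) (N : ℕ) :
    (star (totalNumber *ᵥ (∑ b ∈ S, v b) - (N : ℂ) • (∑ b ∈ S, v b)) ⬝ᵥ
        (totalNumber *ᵥ (∑ b ∈ S, v b) - (N : ℂ) • (∑ b ∈ S, v b))).re =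
      ∑ b ∈ S, (star (v b) ⬝ᵥ v b).re * (((b + e + b : ℕ) : ℝ) - N) ^ 2 := by
  rw [pc_numDev_eq_sum hv S N, pc_norm_split (e := e) (fun b => (hv b).smul _) S, Complex.re_sum]
  refine Finset.sum_congr rfl fun b _ => ?_
  rw [star_smul, smul_dotProduct, dotProduct_smul, smul_smul, smul_eq_mul]
  have hr : (star ((((b + e + b : ℕ) : ℂ) - (N : ℂ))) * (((b + e + b : ℕ) : ℂ) - (N : ℂ))) =
      (((((b + e + b : ℕ) : ℝ) - N) ^ 2 : ℝ) : ℂ) := by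
    have : (((b + e + b : ℕ) : ℂ) - (N : ℂ)) = ((((b + e + b : ℕ) : ℝ) - N : ℝ) : ℂ) := by push_cast; ring
    rw [this, Complex.star_def, Complex.conj_ofReal]
    push_cast; ring
  rw [hr, Complex.re_ofReal_mul, mul_comm]

/-- `0 ≤ Re⟨v, v⟩`. [folklore] -/
theorem pc_re_norm_nonneg {m : Type*} [Fintype m] (v : m → ℂ) : 0 ≤ (star v ⬝ᵥ v).re := by
  rw [← norm_toLp_sq]; positivity

/-- `‖v‖ = (Re⟨v,v⟩)^{1/2}` for the Euclidean norm. [folklore] -/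
theorem pc_norm_toLp_eq_sqrt {m : Type*} [Fintype m] (v : m → ℂ) :
    ‖(WithLp.toLp 2 v : EuclideanSpace ℂ m)‖ = Real.sqrt ((star v ⬝ᵥ v).re) := by
  rw [← norm_toLp_sq, Real.sqrt_sq (norm_nonneg _)]

omit [NeZero L] in
/-- **Grand-canonical floor under a sector energy** (the `κ = 0` case of the landed `stub_sectorFloorGC`, re-proved
here in this file's instance context): `E₀(K_μ) ≤ minEnergyOn H (szSector N 0) − μN` whenever the sector is nonzero
(every unit vector of the sector is a trial vector for `K_μ = H − μN̂`). Tasaki (2020) §2.1, (2.1.6). [folklore] -/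
-- adapted from `CwSsbToEvenTorusLRO.stub_sectorFloorGC` (Theorems/ChiralWindowCwSsbToEvenTorusLROSectorFloorGC.lean)
theorem pc_gcFloor (U μ : ℝ) {N : ℕ}
    (hex : ∃ χ : Fock (Orb (FermionTorus 2 L)), χ ∈ szSector N 0 ∧ χ ≠ 0) :
    (hubbardTorusWith 2 L 1 U μ).groundEnergy ≤ (hubbardTorus 2 L 1 U).minEnergyOn (szSector N 0) - μ * (N : ℝ) := by
  obtain ⟨φ, hφK, hφ0⟩ := hex
  have hA : (hubbardTorusWith 2 L 1 U μ).IsHermitian := isHermitian_hubbardTorusWith L 1 U μ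
  obtain ⟨c, -, hc1⟩ := exists_smul_unit hφ0
  have hne : {E : ℝ | ∃ ψ ∈ szSector N 0, star ψ ⬝ᵥ ψ = 1 ∧
      E = (star ψ ⬝ᵥ (hubbardTorus 2 L 1 U) *ᵥ ψ).re}.Nonempty :=
    ⟨_, c • φ, Submodule.smul_mem _ c hφK, hc1, rfl⟩
  rw [le_sub_iff_add_le]
  unfold Matrix.minEnergyOn
  refine le_csInf hne ?_
  rintro E ⟨ψ, hψK, hψ1, rfl⟩
  have hψN : IsNParticle N ψ := ((mem_szSector_iff N 0 ψ).1 hψK).1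
  have h1 := groundEnergy_le_rayleigh_holds hA ψ hψ1
  have e : hubbardTorusWith 2 L 1 U μ *ᵥ ψ = hubbardTorus 2 L 1 U *ᵥ ψ - (μ : ℂ) • ((N : ℂ) • ψ) := by
    rw [hubbardTorusWith_eq, sub_mulVec, smul_mulVec, totalNumber_mulVec_of_isNParticle hψN]
  rw [e, dotProduct_sub, dotProduct_smul, dotProduct_smul, hψ1, smul_eq_mul, smul_eq_mul, mul_one,
    Complex.sub_re, Complex.re_ofReal_mul, Complex.natCast_re] at h1
  linarith

/-- **Registered helper stub `stub_sectorQuadraticSplit`** (sub-goal of `stub_projectedChord`): quadratic forms of a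
`(N↑, N↓)`-conserving matrix split over the `(b+e, b)` components. [folklore] -/
theorem stub_sectorQuadraticSplit :
    ∀ (L : ℕ) (M : Matrix (Finset (Orb (FermionTorus 2 L))) (Finset (Orb (FermionTorus 2 L))) ℂ), PreservesSectors M → ∀ (e : ℕ) (v : ℕ → Fock (Orb (FermionTorus 2 L))), (∀ b, IsInSector (b + e) b (v b)) → ∀ S : Finset ℕ, star (∑ b ∈ S, v b) ⬝ᵥ (M *ᵥ ∑ b ∈ S, v b) = ∑ b ∈ S, star (v b) ⬝ᵥ (M *ᵥ v b) :=
  fun _ _ hM _ _ hv S => pc_quadratic_split hM hv S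

omit [NeZero L] in
/-- **The sector weights of a weight-`e/2` vector sum to its norm**: `Σ_{b ≤ L²} ‖sectorProj (b+e) b φ‖² = ‖φ‖²` whenever
`S^z φ = (e/2) φ` (the weights `p_b` of the mixing step of file 3/3 sum to one for a unit vector). [folklore] -/
theorem pc_sum_sectorProj_norm {e : ℕ} {φ : Fock (Orb (FermionTorus 2 L))}
    (hZ : HubbardWave0.spinZ *ᵥ φ = (((e : ℝ) / 2 : ℝ) : ℂ) • φ) :
    ∑ b ∈ Finset.range (L ^ 2 + 1), star (sectorProj (b + e) b φ) ⬝ᵥ sectorProj (b + e) b φ = star φ ⬝ᵥ φ := by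
  have h := pc_norm_split (e := e) (v := fun b => sectorProj (b + e) b φ) (fun b => isInSector_sectorProj _ _ _)
    (Finset.range (L ^ 2 + 1))
  rw [pc_sum_sectorProj_of_spinZ hZ] at h
  exact h.symm

end Chord

end Summit.HubbardSuperconductivity.HubbardSuperconductivity.Theorems

end
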